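/-
Copyright: the b2b-balaban cell (near-miss cell 7), T⁴-continuum fan-out, lineage t4-ne7b-p3 (node U5c LARGE-DEVIATION
member P3).  Released under the licence of the surrounding project.
-/
import Literature.MathematicalPhysics.QuantumFieldTheory.Balaban1983to89.B13ScaleTransfer
import Summits.QuantumFields.BalabanUV.T4Continuum.Support.ZoneDiameter

/-!
# Space-time Peierls ∕ Cramér route for NE7b — THE TORUS DICTIONARY: index points of `ℤᵈ` at blocking factor `L^a` are
# torus cells of level `a`, and COARSENING IS THE PARENT RELATION of the space-time cell graph

Summits-side support leaf of the T⁴-continuum cell (rung (B)+1 on a FINITE torus only; NOT infinite volume, NOT the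
mass gap, NOT the Clay statement; NOT a proof of the spine estimate NE7b).  Lineage `t4-ne7b-p3` (generation 2), node
U5c, skeleton `t4/skeletons/NE7b-t4-ne7b-p3.md` §9 (the torus dictionary for `cover` ∕ `Occ`).  [folklore] integer and
finite arithmetic over the torus cell model `Support/ZoneTorus.lean` (lineage t4-ne7b-p1: `TCell`, `IsScale`, `nearT`,
`cycd`; `ZoneDiameter.cycd_self`) and the index model `B13ScaleTransfer.{Pt, coarse}` — imported BY NAME; nothing
printed is asserted; no
`[cite:]` tag.

WHAT.  The CONTOUR route's realised lineages live in the index model `ℤᵈ` (`SpaceTimeRealised`); the space-time cell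
graph lives on the torus (`SpaceTimeCellsVar.STCellV`).  This file is the dictionary:
* §1 `toCell N m hN y` — the torus cell with coordinates `m·y_i mod N` (`Int.emod`, correct for negative coordinates);
  `isScale_toCell`: at `m = L^a` with `L^a ∣ N` it is a cell of scale `a`;
* §2 **`blockIdx_toCell_eq`** — THE ARITHMETIC: for `N = L^{a+e}·c`, the level-`(a+e)` block of `toCell N (L^a) y`
  equals the level-`(a+e)` block of `toCell N (L^{a+e}) (coarse (L^e) y)` (write `y = L^e·y′ + r`, reduce modulo
  `N = L^{a+e}·c`);
* §3 **`nearT_toCell_coarse`** — hence, on the cutoff torus `N = n·L^{Kx}` with `a + e ≤ Kx`, the cell of `y` at level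
  `a` and the cell of `coarse (L^e) y` at level `a + e` are in the PARENT relation of the space-time cell graph
  (`ZoneTorus.nearT … 0`): the vertical chain of the occupancy reading is the image of the index-model chain
  `y ↦ coarse q y`.

HONEST DEPENDENCY (cell, verbatim): continuum YM on T⁴ ⇐ BetaPertH ∧ nine spine estimates (0/9 proved); BetaPertH ⇐
(D1) ∧ (D4) ∧ CAP+tail; G-an2-4 gates asym, D1 and NE2/3/4.  This file changes none of it.
-/

open Finset

namespace Summit.QuantumFields.BalabanUV.T4Continuum.SpaceTimePeierls

open Summit.QuantumFields.BalabanUV.T4Continuum.ZoneTorus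
open Literature.MathematicalPhysics.QuantumFieldTheory.Balaban1983to89.B13ScaleTransfer

/-! ## §1 The torus cell of an index point -/

section ToCell

variable {d : ℕ}

/-- **THE TORUS CELL OF AN INDEX POINT** `y ∈ ℤᵈ` at blocking factor `m` on the torus of side `N > 0`: coordinates
`m·y_i mod N` (Euclidean remainder, in `[0, N)`). [folklore] -/
def toCell (N m : ℕ) (hN : 0 < N) (y : Pt d) : TCell d N :=
  fun i => ⟨(((m : ℤ) * y i) % (N : ℤ)).toNat, by
    have h0 : (0 : ℤ) ≤ ((m : ℤ) * y i) % (N : ℤ) := Int.emod_nonneg _ (by exact_mod_cast hN.ne')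
    have h1 : ((m : ℤ) * y i) % (N : ℤ) < (N : ℤ) := Int.emod_lt_of_pos _ (by exact_mod_cast hN)
    omega⟩

/-- the coordinate of the torus cell, as an integer [folklore] -/
theorem toCell_val (N m : ℕ) (hN : 0 < N) (y : Pt d) (i : Fin d) :
    ((toCell N m hN y i).val : ℤ) = ((m : ℤ) * y i) % (N : ℤ) := by
  simp only [toCell]
  exact Int.toNat_of_nonneg (Int.emod_nonneg _ (by exact_mod_cast hN.ne'))

/-- **A POINT BLOCKED BY `L^a` IS A CELL OF SCALE `a`** (when `L^a ∣ N`). [folklore] -/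
theorem isScale_toCell {N L a : ℕ} (hN : 0 < N) (hdvd : L ^ a ∣ N) (y : Pt d) : IsScale L a (toCell N (L ^ a) hN y) := by
  intro i
  have hz : ((L ^ a : ℕ) : ℤ) ∣ (((L ^ a : ℕ) : ℤ) * y i) % (N : ℤ) := by
    rw [Int.emod_def]
    exact dvd_sub (dvd_mul_right _ _) ((Int.natCast_dvd_natCast.2 hdvd).mul_right _)
  have hv := toCell_val N (L ^ a) hN y i
  rw [← hv] at hz
  exact Int.natCast_dvd_natCast.1 hz

end ToCell

/-! ## §2 The arithmetic: coarsening and blocking commute on the torus -/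

section Blocks

variable {d : ℕ}

/-- Euclidean division bookkeeping: for `0 < M'`, `0 ≤ v < M'` and `0 ≤ u`, `((M'·u + v).toNat) / M'.toNat = u.toNat`.
[folklore] -/
theorem toNat_div_of_small {M' u v : ℤ} (hM : 0 < M') (hu : 0 ≤ u) (hv0 : 0 ≤ v) (hv : v < M') :
    (M' * u + v).toNat / M'.toNat = u.toNat := by
  have h1 : (M' * u + v).toNat = M'.toNat * u.toNat + v.toNat := by
    have : M' * u + v = ((M'.toNat * u.toNat + v.toNat : ℕ) : ℤ) := by
      push_cast
      rw [Int.toNat_of_nonneg hM.le, Int.toNat_of_nonneg hu, Int.toNat_of_nonneg hv0]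
    rw [this, Int.toNat_natCast]
  have hMn : 0 < M'.toNat := by omega
  have hvn : v.toNat < M'.toNat := by omega
  rw [h1, Nat.mul_add_div hMn, Nat.div_eq_of_lt hvn, add_zero]

/-- **COARSENING AND BLOCKING COMMUTE ON THE TORUS.**  With `M = L^a`, `M' = L^{a+e}`, `N = M'·c` (`L, c > 0`): the
level-`(a+e)` block index `⌊(M·y mod N) ∕ M'⌋` of the cell of `y` at factor `M` equals the block index
`⌊(M'·⌊y∕L^e⌋ mod N) ∕ M'⌋` of the cell of `coarse (L^e) y` at factor `M'`. [folklore] -/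
theorem blockIdx_toCell_eq {L a e c : ℕ} (hL : 0 < L) (hc : 0 < c) {N : ℕ} (hNdef : N = L ^ (a + e) * c) (hN : 0 < N)
    (y : Pt d) (i : Fin d) :
    (toCell N (L ^ a) hN y i).val / L ^ (a + e) = (toCell N (L ^ (a + e)) hN (coarse (L ^ e) y) i).val / L ^ (a + e) := by
  -- integer names
  set M : ℤ := ((L ^ a : ℕ) : ℤ) with hM
  set k : ℤ := ((L ^ e : ℕ) : ℤ) with hk
  set M' : ℤ := ((L ^ (a + e) : ℕ) : ℤ) with hM'
  have hMpos : 0 < M := by rw [hM]; exact_mod_cast pow_pos hL a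
  have hkpos : 0 < k := by rw [hk]; exact_mod_cast pow_pos hL e
  have hM'pos : 0 < M' := by rw [hM']; exact_mod_cast pow_pos hL (a + e)
  have hMk : M * k = M' := by rw [hM, hk, hM']; push_cast; rw [← pow_add]
  have hcpos : (0 : ℤ) < c := by exact_mod_cast hc
  have hNz : (N : ℤ) = M' * c := by rw [hNdef, hM']; push_cast; ring
  -- Euclidean divisions `y = k·y' + r`, `y' = c·q + w`
  set y' : ℤ := y i / k with hy'
  set r : ℤ := y i % k with hr
  have hyr : k * y' + r = y i := Int.mul_ediv_add_emod _ _
  have hr0 : 0 ≤ r := Int.emod_nonneg _ hkpos.ne'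
  have hrk : r < k := Int.emod_lt_of_pos _ hkpos
  set w : ℤ := y' % c with hw
  have hyw : (c : ℤ) * (y' / c) + w = y' := Int.mul_ediv_add_emod _ _
  have hw0 : 0 ≤ w := Int.emod_nonneg _ hcpos.ne'
  have hwc : w < c := Int.emod_lt_of_pos _ hcpos
  -- the coarse coordinate is `y'`
  have hcoarse : coarse (L ^ e) y i = y' := by simp [coarse, hy', hk]
  -- left side: `M·y mod N = M'·w + M·r`
  have hA : (M * y i) % (N : ℤ) = M' * w + M * r := by
    have hdecomp : M * y i = (N : ℤ) * (y' / c) + (M' * w + M * r) := by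
      rw [hNz, ← hyr, ← hMk]
      calc M * (k * y' + r) = M * k * y' + M * r := by ring
        _ = M * k * ((c : ℤ) * (y' / c) + w) + M * r := by rw [hyw]
        _ = M * k * c * (y' / c) + (M * k * w + M * r) := by ring
    have hlt : M' * w + M * r < (N : ℤ) := by
      rw [hNz]
      have h1 : M * r < M' := by
        calc M * r < M * k := Int.mul_lt_mul_of_pos_left hrk hMpos
          _ = M' := hMk
      have h2 : M' * w ≤ M' * (c - 1) := Int.mul_le_mul_of_nonneg_left (by omega) hM'pos.le
      nlinarith
    have hge : 0 ≤ M' * w + M * r := by positivity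
    rw [hdecomp, Int.mul_add_emod_self_left, Int.emod_eq_of_lt hge hlt]
  -- right side: `M'·y' mod N = M'·w`
  have hB : (M' * y') % (N : ℤ) = M' * w := by
    rw [hNz, Int.mul_emod_mul_of_pos _ _ hM'pos]
  -- compare the block indices
  have hvA := toCell_val N (L ^ a) hN y i
  have hvB := toCell_val N (L ^ (a + e)) hN (coarse (L ^ e) y) i
  rw [hcoarse] at hvB
  rw [← hM] at hvA
  rw [← hM'] at hvB
  rw [hA] at hvA
  rw [hB] at hvB
  -- cast the ℕ coordinates
  have hMn : (L ^ (a + e) : ℕ) = M'.toNat := by rw [hM', Int.toNat_natCast]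
  have eA : (toCell N (L ^ a) hN y i).val = (M' * w + M * r).toNat := by
    have := congrArg Int.toNat hvA; rwa [Int.toNat_natCast] at this
  have eB : (toCell N (L ^ (a + e)) hN (coarse (L ^ e) y) i).val = (M' * w + 0).toNat := by
    have := congrArg Int.toNat hvB; rw [Int.toNat_natCast] at this; rw [this, add_zero]
  rw [eA, eB, hMn, toNat_div_of_small hM'pos hw0 (by positivity) (by
      calc M * r < M * k := Int.mul_lt_mul_of_pos_left hrk hMpos
        _ = M' := hMk),
    toNat_div_of_small hM'pos hw0 le_rfl hM'pos]

end Blocks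

/-! ## §3 Coarsening is the parent relation of the space-time cell graph -/

section Parent

variable {d : ℕ}

/-- **COARSENING IS THE PARENT RELATION.**  On the cutoff torus of side `n·L^{Kx}` (`n, L > 0`), for levels
`a + e ≤ Kx`: the cell of `y` at level `a` and the cell of `coarse (L^e) y` at level `a + e` are vertically related —
`nearT n L Kx (cell of y) a (cell of coarse y) (a+e) (a+e) 0` (the latter's level-`(a+e)` block contains the former).
[folklore] -/
theorem nearT_toCell_coarse {n L Kx a e : ℕ} (hn : 0 < n) (hL : 0 < L) (hae : a + e ≤ Kx)
    (hN : 0 < n * L ^ Kx) (y : Pt d) :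
    nearT n L Kx (toCell (n * L ^ Kx) (L ^ a) hN y) a
      (toCell (n * L ^ Kx) (L ^ (a + e)) hN (coarse (L ^ e) y)) (a + e) (a + e) 0 := by
  have hNdef : n * L ^ Kx = L ^ (a + e) * (n * L ^ (Kx - (a + e))) := by
    rw [mul_left_comm, ← pow_add, Nat.add_sub_cancel' hae]
  have hc : 0 < n * L ^ (Kx - (a + e)) := Nat.mul_pos hn (pow_pos hL _)
  refine ⟨hae, ?_, ?_, fun i => ?_⟩
  · exact isScale_toCell hN ((pow_dvd_pow L (by omega : a ≤ Kx)).mul_left n) y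
  · exact isScale_toCell hN (Dvd.intro _ hNdef.symm) _
  · rw [blockIdx_toCell_eq hL hc hNdef hN y i, cycd_self]
    simp

end Parent

end Summit.QuantumFields.BalabanUV.T4Continuum.SpaceTimePeierls
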